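import Literature.AlgebraicGeometry.HodgeTheory.BettiUniverseEigenspacePieces
import Literature.AlgebraicGeometry.HodgeTheory.ComplexConjugationHolds
import Literature.AlgebraicGeometry.HodgeTheory.HodgeFiltrationModelsReductionProofs
import Literature.AlgebraicGeometry.Motives.HodgeStructureWeilOperator
import HarnessLib

/-!
# K2Q brick C-Q (part 1): a cohomological deck map whose `+1`-eigenspace carries no `(2,0)`-class acts trivially
# modulo divisors — the `+1`-eigenspace of `σ^*` on `H²` consists of Hodge classes

Cell `hodge-nonav`, prover seat `hodge-nonav-20241-p1` (g20); programme K2Q (crux `PowersHodgeOfQuaternionCommutators`,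
stmt-HodgeConjecture-24191, route `Q8SymplecticPowers`; memo `PROGRAMME-K2Q-20241p1-g20.md` brick C-Q (ii)). HELPER FILE
(`--supports stmt-HodgeConjecture-24191 --as helper`). Sorry-free; axioms standard.

The crux binds a smooth projective surface `X`, self-maps with `dim_ℂ (ker(z_ℂ − 1) ∩ H^{2,0}) = 0` for the central element
`z = (τ^*)²` of the cohomological quaternion deck pair, and a «quaternionic centraliser» `Uni` whose elements fix the Hodge
classes `hodgeClasses 1` of `H²(X; ℚ)` pointwise. This file supplies the comparison that lets the centraliser act on the
TRANSCENDENTAL side only: the rational `+1`-eigenspace of a self-map `σ^*` of `H²(X; ℚ)` whose complexification meets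
`H^{2,0}` trivially consists of HODGE CLASSES (`σ^*` is a morphism of Hodge structures, so the Hodge components of a
`σ^*_ℂ`-fixed vector are `σ^*_ℂ`-fixed; the `(2,0)`-component vanishes by hypothesis, the `(0,2)`-component by complex
conjugation, and the components off `0 ≤ p ≤ 2` vanish on `H²` of a smooth projective variety), hence is fixed pointwise by
every `Uni` element; applied to `σ = τ ≫ τ` this is `V₊ := ker((τ^*)² − 1) ⊆ NS_ℚ`.

* `eigenspace_pull_le_hodgeClasses` — `ker(σ^* − 1) ≤ (hodge hX 2).hodgeClasses 1` if `ker(σ^*_ℂ − 1) ∩ H^{2,0} = 0`;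
* `eigenspace_pull_sq_le_hodgeClasses` — the same for `(τ^*)²` (`= (τ ≫ τ)^*`), the shape of the crux's deck clause;
* `apply_eq_self_of_mem_eigenspace_pull_sq` — consequently every `g` fixing `hodgeClasses 1` pointwise fixes `V₊` pointwise.

Honest scope: linear-algebraic bookkeeping; nothing here says HC, HC_CM or HC_AV is proved.

References: C. Voisin, *Hodge Theory I* (2002), §7.3.1–7.3.2 (morphisms of Hodge structures), §7.1.1 Def. 7.4, §11.3 (Hodge
classes); P. Deligne, Théorie de Hodge II (1971), 1.2.5.
-/

set_option linter.dupNamespace false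

noncomputable section

open scoped TensorProduct
open CategoryTheory
open Literature.AlgebraicGeometry.Motives Literature.AlgebraicGeometry.HodgeTheory
open Literature.AlgebraicGeometry.HodgeTheory.BettiUniverse
open Literature.AlgebraicGeometry.Motives.HodgeStructure

namespace Summit.HodgeConjecture.HodgeConjecture.Theorems.Q8SymplecticPowersDeckEigenHodge

variable {X : SchemeOver ℂ}

/-- **The `+1`-eigenspace of a cohomological self-map with no `(2,0)`-part consists of Hodge classes.** For a smooth
projective surface `X`, a morphism `σ : X ⟶ X` and the Hodge structure `H = hodge hHD hX 2` on `H²(X(ℂ); ℚ)`: if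
`ker(σ^*_ℂ − 1) ∩ H^{2,0} = 0` (as `dim_ℂ = 0`), then every rational class `v` with `σ^* v = v` is a Hodge class
(`v ∈ H.hodgeClasses 1`). [cite: VoisinHodgeI2002, §7.3.2 and §7.1.1 Def. 7.4] [cite: DeligneHodgeII1971, 1.2.5] -/
theorem eigenspace_pull_le_hodgeClasses (hX : IsSmoothProjective 2 X) (σ : X ⟶ X)
    (h20 : Module.finrank ℂ ↥(Module.End.eigenspace ((pull σ 2).baseChange ℂ) 1 ⊓
      (hodge exists_isReal_hodgeModel_holds hX 2).piece 2 0) = 0) :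
    Module.End.eigenspace (pull σ 2) 1 ≤ (hodge exists_isReal_hodgeModel_holds hX 2).hodgeClasses 1 := by
  classical
  intro v hv
  haveI := finite hX 2
  set H := hodge exists_isReal_hodgeModel_holds hX 2 with hH
  -- `σ^*` as a morphism of Hodge structures
  let f : Hom H H := pullHodgeHom exists_isReal_hodgeModel_holds hodgePQ_independent_of_hodgeModel_holds hX hX σ 2
  have hf : f.toLinearMap = pull σ 2 := rfl
  have hv' : pull σ 2 v = v := by
    have h := Module.End.mem_eigenspace_iff.1 hv
    rwa [one_smul] at h
  set x : ℂ ⊗[ℚ] bettiCohomology X 2 := ofRat v with hx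
  have hfix : (pull σ 2).baseChange ℂ x = x := by
    rw [hx, ofRat_apply, LinearMap.baseChange_tmul, hv']
  -- the Hodge components of `x` are `σ^*_ℂ`-fixed
  have hcomp : ∀ p, (pull σ 2).baseChange ℂ (H.pieceProj p x) = H.pieceProj p x := fun p ↦ by
    rw [← hf, f.baseChange_pieceProj p x, hf, hfix]
  -- the `(2,0)`-component vanishes
  have hbot : Module.End.eigenspace ((pull σ 2).baseChange ℂ) 1 ⊓ H.piece 2 0 = ⊥ :=
    Submodule.finrank_eq_zero.1 h20
  have h2 : H.pieceProj 2 x = 0 := by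
    have hmem : H.pieceProj 2 x ∈ Module.End.eigenspace ((pull σ 2).baseChange ℂ) 1 ⊓ H.piece 2 0 := by
      refine Submodule.mem_inf.2 ⟨?_, ?_⟩
      · rw [Module.End.mem_eigenspace_iff, one_smul]
        exact hcomp 2
      · have h := H.pieceProj_mem 2 x
        rwa [show ((2 : ℕ) : ℤ) - 2 = 0 by norm_num] at h
    rw [hbot] at hmem
    exact (Submodule.mem_bot ℂ).1 hmem
  -- the `(0,2)`-component vanishes by conjugation (`x` is real)
  have h0 : H.pieceProj 0 x = 0 := by
    have h := H.conj_pieceProj 2 x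
    rw [h2, map_zero, hx, conj_ofRat, show ((2 : ℕ) : ℤ) - 2 = 0 by norm_num] at h
    rw [hx]
    exact h.symm
  -- the components off `0 ≤ p ≤ 2` vanish on `H²(X)`
  have hoff : ∀ p : ℤ, p ≠ 0 → p ≠ 1 → p ≠ 2 → H.pieceProj p x = 0 := by
    intro p hp0 hp1 hp2
    have hmem := H.pieceProj_mem p x
    rcases lt_or_gt_of_ne hp0 with hlt | hgt
    · rw [hodge_piece_eq_bot_of_lt_right exists_isReal_hodgeModel_holds hX 2 (by push_cast; omega)] at hmem
      exact (Submodule.mem_bot ℂ).1 hmem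
    · rw [hodge_piece_eq_bot_of_lt exists_isReal_hodgeModel_holds hX 2 (by push_cast; omega)] at hmem
      exact (Submodule.mem_bot ℂ).1 hmem
  -- hence `x = x^{1,1} ∈ V^{1,1} ⊆ F¹`
  have hx11 : x = H.pieceProj 1 x := by
    rw [← sub_eq_zero]
    refine H.eq_zero_of_forall_pieceProj_eq_zero fun p ↦ ?_
    rw [map_sub]
    by_cases hp1 : p = 1
    · subst hp1
      rw [H.pieceProj_apply_of_mem (H.pieceProj_mem 1 x), sub_self]
    · rw [H.pieceProj_apply_of_mem_ne (Ne.symm hp1) (H.pieceProj_mem 1 x), sub_zero]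
      by_cases hp0 : p = 0
      · subst hp0; exact h0
      by_cases hp2 : p = 2
      · subst hp2; exact h2
      exact hoff p hp0 hp1 hp2
  have hxF : x ∈ H.F 1 := by
    rw [hx11]
    exact H.piece_le_F 1 _ (H.pieceProj_mem 1 x)
  exact (H.mem_hodgeClasses_iff 1 v).2 hxF

/-- **The `+1`-eigenspace of `z = (τ^*)²` consists of Hodge classes** when `ker(z_ℂ − 1) ∩ H^{2,0} = 0` — the shape of the
deck clause of the crux `PowersHodgeOfQuaternionCommutators` (`(τ^*)² = (τ ≫ τ)^*`).
[cite: VoisinHodgeI2002, §7.3.2 and §7.1.1 Def. 7.4] -/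
theorem eigenspace_pull_sq_le_hodgeClasses (hX : IsSmoothProjective 2 X) (τ : X ⟶ X)
    (h20 : Module.finrank ℂ ↥(Module.End.eigenspace ((pull τ 2 ^ 2).baseChange ℂ) 1 ⊓
      (hodge exists_isReal_hodgeModel_holds hX 2).piece 2 0) = 0) :
    Module.End.eigenspace (pull τ 2 ^ 2) 1 ≤ (hodge exists_isReal_hodgeModel_holds hX 2).hodgeClasses 1 := by
  have hsq : pull τ 2 ^ 2 = pull (τ ≫ τ) 2 := by
    rw [pow_two, pull_comp τ τ 2]
    rfl
  rw [hsq] at h20 ⊢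
  exact eigenspace_pull_le_hodgeClasses hX (τ ≫ τ) h20

/-- **Every endomorphism fixing the Hodge classes of `H²` pointwise fixes `V₊ = ker((τ^*)² − 1)` pointwise** (the last
clause of the crux's `Uni`), granted the deck clause `dim_ℂ (ker(z_ℂ − 1) ∩ H^{2,0}) = 0`. [cite: VoisinHodgeI2002, §7.3.2] -/
theorem apply_eq_self_of_mem_eigenspace_pull_sq (hX : IsSmoothProjective 2 X) (τ : X ⟶ X)
    (h20 : Module.finrank ℂ ↥(Module.End.eigenspace ((pull τ 2 ^ 2).baseChange ℂ) 1 ⊓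
      (hodge exists_isReal_hodgeModel_holds hX 2).piece 2 0) = 0)
    (g : bettiCohomology X 2 ≃ₗ[ℚ] bettiCohomology X 2)
    (hg : ∀ x ∈ (hodge exists_isReal_hodgeModel_holds hX 2).hodgeClasses 1, g x = x)
    {v : bettiCohomology X 2} (hv : (pull τ 2 ^ 2) v = v) : g v = v :=
  hg v (eigenspace_pull_sq_le_hodgeClasses hX τ h20 (Module.End.mem_eigenspace_iff.2 (by rw [one_smul]; exact hv)))

end Summit.HodgeConjecture.HodgeConjecture.Theorems.Q8SymplecticPowersDeckEigenHodge

end
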